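import Literature.Analysis.FluidPDE.LeiZhang2011RegularityCase1Loc
import Literature.Analysis.FluidPDE.LeiZhang2011RegularityCase2Loc
import Literature.Analysis.FluidPDE.LeiZhang2011RegularityOfSwirlStep
import HarnessLib

/-!
# Lei–Zhang 2011, Theorem 1.4 (classical frame) with the swirl bounded only in a tube near the
# final time

Analysis/FluidPDE **proofs file** (theorems only: no definitions, no named facts, no `sorry`)
on the discharge path of `Literature.Analysis.FluidPDE.LeiZhang2011_regularity_bmoStream`
(Z. Lei, Q. S. Zhang, J. Funct. Anal. 261 (2011) = arXiv:1011.5066, **Theorem 1.4**, proof §4,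
pp. 12–13). `LeiZhang2011_regularity_classical_of_swirlStepU` (`LeiZhang2011RegularityUniform`)
assumed `|Γ| = |r u^θ| ≤ C₁` on the whole slab `(0, T) × ℝ³` — the printed "by the assumption on
initial value and the maximum principle" (p. 12). For a Leray–Hopf solution on an epoch ending at
a (potential) singular time only a **local** bound is available (the local maximum estimate of
§2, `LeiZhang2011.abs_swirl_le_local_of_classical`, in a tube `r ≤ ρ` around the axis for
`t ∈ (T₁, T)`), together with boundedness of the velocity **off** the tube near the final time
(partial regularity). This file runs the blow-up argument of §4 under exactly these two
hypotheses:

* `LeiZhang2011_regularity_classical_local` — a classical solution of the unforced system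
  (`ν = 1`) on `(0, T) × ℝ³`, bounded on every earlier slab, with axisymmetric slices and a
  stream function with `BMO` slices, with (H1) `|Γ(t, x)| ≤ C₁` for `t ∈ (T₁, T)`, `r(x) ≤ ρ`
  and (H2) `‖u(t, x)‖ ≤ M₀` for `t ∈ (T₁, T)`, `r(x) ≥ ρ/2`, is bounded on `(0, T) × ℝ³`:
  near-maxima `(t_n, x_n)` with `M_n → ∞` have `t_n → T` and, by (H2), `r(x_n) < ρ/2`; the
  rescaled windows eventually lie in the tube, so (H1) is all that the two cases consume
  (`case1_falseLoc`, `case2_falseLoc`), given the swirl step `hstep`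
  (`swirlStepU_holds`, `LeiZhang2011GaugeFix`).

## References

* Z. Lei, Q. S. Zhang, J. Funct. Anal. 261 (2011) = arXiv:1011.5066: Thm. 1.4 and proof §4
  (pp. 12–13), §2 (2.6). [LeiZhang2011]
* G. Koch, N. Nadirashvili, G. Seregin, V. Šverák, Acta Math. 203 (2009), §6.
  [KochNadirashviliSereginSverak2009]
-/

noncomputable section

open MeasureTheory Set Function Filter Topology TopologicalSpace Metric
open scoped InnerProductSpace RealInnerProductSpace NNReal

namespace Literature.Analysis.FluidPDE

open Literature.Analysis.FunctionSpaces SereginSverak2009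

/-- **Lei–Zhang 2011, Theorem 1.4 (classical frame), with the swirl bounded in a tube near the
final time and the velocity bounded off the tube.** Let `(u, p)` be a classical solution of the
unforced Navier–Stokes system (`ν = 1`) on `(0, T) × ℝ³`, bounded on every `(0, T') × ℝ³`,
`T' < T`, with axisymmetric slices and a stream function with `BMO` slices, and let `T₁ < T`,
`ρ > 0` with (H1) `|Γ(t, x)| ≤ C₁` for `t ∈ (T₁, T)`, `r(x) ≤ ρ`, and (H2) `‖u(t, x)‖ ≤ M₀` for
`t ∈ (T₁, T)`, `r(x) ≥ ρ/2`. Assume the swirl step `hstep` (proved: `swirlStepU_holds`). Then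
`u` is bounded on `(0, T) × ℝ³`. Printed proof (§4, pp. 12–13) with the swirl bound consumed only
in the blow-up limits (`case1_falseLoc`, `case2_falseLoc`); the near-maxima lie in the half
tube by (H2), and their times tend to `T`.
[cite: LeiZhang2011, Thm. 1.4 and its proof §4 (arXiv pp. 12–13)] -/
theorem LeiZhang2011_regularity_classical_local
    (hstep : ∀ (v : ℝ → EuclideanSpace ℝ (Fin 3) → EuclideanSpace ℝ (Fin 3)) (C : ℝ)
      (K' : ℝ≥0),
      IsBoundedWeakNSSolutionOn (Iio 0) isOpen_Iio 1 v → Continuous (uncurry v) →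
      (∀ t < 0, IsAxisymmetric (v t)) → (∀ t < 0, ∀ x, |swirl (v t) x| ≤ C) →
      (∀ t < 0, ∃ Bt : EuclideanSpace ℝ (Fin 3) → EuclideanSpace ℝ (Fin 3),
        LocallyIntegrable Bt volume ∧ eBMOSeminormVec Bt ≤ K' ∧
        ∀ (φ : EuclideanSpace ℝ (Fin 3) → ℝ) (e : EuclideanSpace ℝ (Fin 3)),
          ContDiff ℝ 1 φ → HasCompactSupport φ →
            ∫ x, φ x * ⟪v t x, e⟫ = ∫ x, ⟪cross (Bt x) (gradient φ x), e⟫) →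
      ∀ t < 0, HasNoSwirl (v t))
    {T : ℝ} {u : ℝ → EuclideanSpace ℝ (Fin 3) → EuclideanSpace ℝ (Fin 3)}
    {p : ℝ → EuclideanSpace ℝ (Fin 3) → ℝ} (hT : 0 < T)
    (h : IsClassicalNSSolutionOn (Ioo 0 T) 1 0 u p)
    (hbdd : ∀ T' < T, ∃ M : ℝ, ∀ t ∈ Ioo 0 T', ∀ x, ‖u t x‖ ≤ M)
    (haxi : ∀ t ∈ Ioo 0 T, IsAxisymmetric (u t))
    (hB : ∃ (B : ℝ → EuclideanSpace ℝ (Fin 3) → EuclideanSpace ℝ (Fin 3)) (K : ℝ≥0),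
      HasBMOStreamFunctionOn (Ioo 0 T) u B K)
    {T₁ ρ : ℝ} (hT₁ : T₁ < T) (hρ : 0 < ρ)
    (hΓ : ∃ C₁ : ℝ, ∀ t ∈ Ioo T₁ T, ∀ x, cylRadius x ≤ ρ → |swirl (u t) x| ≤ C₁)
    (hoff : ∃ M₀ : ℝ, ∀ t ∈ Ioo T₁ T, ∀ x, ρ / 2 ≤ cylRadius x → ‖u t x‖ ≤ M₀) :
    ∃ M : ℝ, ∀ t ∈ Ioo 0 T, ∀ x, ‖u t x‖ ≤ M := by
  obtain ⟨C₁, hC₁⟩ := hΓ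
  obtain ⟨M₀, hM₀⟩ := hoff
  obtain ⟨Bs, Kb, hBs⟩ := hB
  by_contra hunb
  -- an intermediate time `T₂ ∈ (T₁, T)`, `T₂ ≥ 3T/4`, and a bound on `(0, T₂) × ℝ³`
  set T₂ : ℝ := (max T₁ (3 * T / 4) + T) / 2 with hT₂
  have hT₂T : T₂ < T := by
    have : max T₁ (3 * T / 4) < T := max_lt hT₁ (by linarith)
    rw [hT₂]; linarith
  have hT₁T₂ : T₁ < T₂ := by
    have := le_max_left T₁ (3 * T / 4); rw [hT₂]; linarith
  have h34 : 3 * T / 4 ≤ T₂ := by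
    have := le_max_right T₁ (3 * T / 4); rw [hT₂]; linarith
  obtain ⟨Bbar, hBbar⟩ := hbdd T₂ hT₂T
  -- the near-maxima, above the thresholds `|Bbar|` and `|M₀|`, rotated onto the meridian plane
  have hsel := fun n : ℕ => exists_near_max hbdd hunb
    (((n : ℝ) + 3) * (1 + 1 / T) + |Bbar| + |M₀|)
  choose tn htn xn' hR' hmax' using hsel
  have hmer := fun n : ℕ => exists_meridian_point_norm_eq (haxi _ (htn n)) (xn' n)
  choose xn hx1 hx0 _hx2 hnorm using hmer
  have hR : ∀ n : ℕ, ((n : ℝ) + 3) * (1 + 1 / T) + |Bbar| + |M₀| < ‖u (tn n) (xn n)‖ :=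
    fun n => by rw [hnorm]; exact hR' n
  have hmax : ∀ n, ∀ s ∈ Ioc 0 (tn n), ∀ y, ‖u s y‖ ≤ 2 * ‖u (tn n) (xn n)‖ := fun n => by
    rw [hnorm]; exact hmax' n
  have hcyl : ∀ n, cylRadius (xn n) = xn n 0 := fun n =>
    cylRadius_eq_apply_zero (hx1 n) (by rw [hx0]; exact cylRadius_nonneg _)
  set M : ℕ → ℝ := fun n => ‖u (tn n) (xn n)‖ with hMdef
  have hRpos : ∀ n : ℕ, (3 : ℝ) ≤ ((n : ℝ) + 3) * (1 + 1 / T) := fun n => by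
    have h1 : (1 : ℝ) ≤ 1 + 1 / T := by simp [hT.le]
    nlinarith [n.cast_nonneg (α := ℝ)]
  have hM1 : ∀ n : ℕ, ((n : ℝ) + 3) * (1 + 1 / T) ≤ M n := fun n => by
    have := hR n; linarith [abs_nonneg Bbar, abs_nonneg M₀]
  have hMone : ∀ n, 1 ≤ M n := fun n => by linarith [hRpos n, hM1 n]
  have hMpos : ∀ n, 0 < M n := fun n => by linarith [hMone n]
  have hMM₀ : ∀ n, M₀ < M n := fun n => by
    have := hR n; linarith [abs_nonneg Bbar, le_abs_self M₀, hRpos n]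
  -- the times are at least `T₂`, hence in `(T₁, T)`
  have htnT₂ : ∀ n, T₂ ≤ tn n := fun n => by
    by_contra hlt
    push Not at hlt
    have h1 : M n ≤ Bbar := hBbar (tn n) ⟨(htn n).1, hlt⟩ (xn n)
    have h2 : |Bbar| < M n := by have := hR n; linarith [hRpos n, abs_nonneg M₀]
    linarith [le_abs_self Bbar]
  have htn₁ : ∀ n, tn n ∈ Ioo T₁ T := fun n => ⟨hT₁T₂.trans_le (htnT₂ n), (htn n).2⟩
  have htn34 : ∀ n, 3 * T / 4 ≤ tn n := fun n => h34.trans (htnT₂ n)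
  -- the near-maxima lie in the half tube (H2)
  have hrn : ∀ n, cylRadius (xn n) ≤ ρ / 2 := fun n => by
    by_contra hlt
    push Not at hlt
    have h1 : ‖u (tn n) (xn n)‖ ≤ M₀ := hM₀ (tn n) (htn₁ n) (xn n) hlt.le
    linarith [hMM₀ n]
  -- `t_n M_n² ≥ (n + 3)(3/4)`, `t_n M_n² → ∞`, `M_n → ∞`, `t_n → T`
  have hAle : ∀ n : ℕ, ((n : ℝ) + 3) * (3 / 4) ≤ tn n * M n ^ 2 := fun n => by
    have h1 : ((n : ℝ) + 3) * (1 + 1 / T) * 1 ≤ M n * M n :=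
      mul_le_mul (hM1 n) (hMone n) zero_le_one (hMpos n).le
    have h2 : T * (1 + 1 / T) = T + 1 := by field_simp
    have h3 : 3 * T / 4 * (((n : ℝ) + 3) * (1 + 1 / T)) ≤ tn n * M n ^ 2 := by
      rw [sq]
      exact mul_le_mul (htn34 n) (by simpa using h1) (by nlinarith [hRpos n]) (htn n).1.le
    have h4 : 3 * T / 4 * (((n : ℝ) + 3) * (1 + 1 / T)) = ((n : ℝ) + 3) * (3 / 4) * (T + 1) := by
      rw [← h2]; ring
    nlinarith [n.cast_nonneg (α := ℝ)]
  have hA2 : ∀ n, 2 ≤ tn n * M n ^ 2 := fun n => by nlinarith [hAle n, n.cast_nonneg (α := ℝ)]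
  have hAtop : Tendsto (fun n => tn n * M n ^ 2) atTop atTop := by
    refine tendsto_atTop_mono hAle ?_
    exact (tendsto_natCast_atTop_atTop.atTop_add tendsto_const_nhds).atTop_mul_const (by norm_num)
  have hMtop : Tendsto M atTop atTop := by
    refine tendsto_atTop_mono hM1 ?_
    exact (tendsto_natCast_atTop_atTop.atTop_add tendsto_const_nhds).atTop_mul_const
      (by have : (0 : ℝ) < 1 + 1 / T := by positivity
          exact this)
  have htnT : Tendsto tn atTop (𝓝 T) := by
    rw [tendsto_order]
    refine ⟨fun a ha => ?_, fun a ha => Eventually.of_forall fun n => (htn n).2.trans ha⟩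
    -- eventually `t_n > a`: otherwise `M_n ≤` the bound on `(0, (a + T)/2)`
    set a' : ℝ := (max a 0 + T) / 2 with ha'
    have ha'T : a' < T := by
      have : max a 0 < T := max_lt ha hT
      rw [ha']; linarith
    have haa' : a < a' := by
      have := le_max_left a 0; rw [ha']; linarith
    obtain ⟨B', hB'⟩ := hbdd a' ha'T
    refine (hMtop.eventually (eventually_gt_atTop B')).mono fun n hn => ?_
    by_contra hle
    push Not at hle
    have h1 : M n ≤ B' := hB' (tn n) ⟨(htn n).1, lt_of_le_of_lt hle haa'⟩ (xn n)
    linarith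
  -- the dichotomy on `r_n M_n`
  by_cases hcase : ∃ D : ℝ, ∃ᶠ n in atTop, M n * xn n 0 ≤ D
  · -- Case 1: `r_n M_n` bounded along a subsequence
    obtain ⟨D, hD⟩ := hcase
    obtain ⟨σ, hσ, hσD⟩ := extraction_of_frequently_atTop hD
    exact case1_falseLoc h haxi hT₁ hρ hC₁ hBs hstep (tn := tn ∘ σ) (xn := xn ∘ σ)
      (fun n => htn (σ n)) (htnT.comp hσ.tendsto_atTop)
      (fun n => hMpos (σ n)) (hMtop.comp hσ.tendsto_atTop) (fun n => hmax (σ n))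
      (fun n => hA2 (σ n)) (hAtop.comp hσ.tendsto_atTop) (D := D) fun n => by
        show cylRadius (xn (σ n)) * M (σ n) ≤ D
        rw [hcyl, mul_comm]; exact hσD n
  · -- Case 2: `r_n M_n → ∞`
    simp only [not_exists, not_frequently, not_le] at hcase
    have hRt : Tendsto (fun n => M n * xn n 0) atTop atTop :=
      tendsto_atTop.2 fun D => (hcase D).mono fun n hn => hn.le
    exact case2_falseLoc h haxi hT₁ hρ hC₁ hBs htn htnT hx1 hrn hMpos hMtop hmax hA2 hAtop hRt

end Literature.Analysis.FluidPDE
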